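import Literature.Barriers.Parity.SiegelZeroPrimePairs
import Literature.Barriers.Parity.SiegelZeroDichotomy
import Literature.Barriers.Parity.BrunTitchmarshSiegelZero
import Literature.NumberTheory.Sieve.MontgomeryVaughan1975Tools
import HarnessLib
import Summits.Parity.GeneralizedHardyLittlewood.Theorems.UnboundedSiegelZeros

/-!
# The weak Hardy–Littlewood–Goldbach conjecture excludes exceptional zeros (Friedlander–Iwaniec 2022)

Statement layer for the «illusory world» column — an EXIT («X ⇒ no Siegel zeros»), topic
«Goldbach». Source: J. B. Friedlander, H. Iwaniec, *Exceptional zeros, sieve parity, Goldbach*,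
Essential Number Theory 1 (2022) 13–39 [FriedlanderIwaniec2022] (held), §1 (1-1)–(1-2), §4
(4-1)–(4-3) and the Theorem of §4 (p. 21), §5 Conclusion (5-4); the Theorem is proved in
Friedlander–Goldston–Iwaniec–Suriajaya, J. Number Theory 233 (2022) 78–86 [FriedlanderEtAl2022]
(not held; acq-06038) and Friedlander–Iwaniec 2021, and is recorded here AS STATED in the held
survey by two of its authors.

The tree already PROVES the weaker exit of Goldston–Suriajaya
(`Literature.Barriers.Parity.GoldstonSuriajaya2021_goldbach_holds`: the same conjecture forces
`β₁ < 1 − C(δ)/log² q`, «narrowing the escape window»). The Theorem of §4 CLOSES the window: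
«Assume that the Weak Hardy–Littlewood–Goldbach conjecture holds for all sufficiently large even
`n`. Then, there are no zeros of any Dirichlet `L`-function in the region (1-1)
[`σ ≥ 1 − c/log q(|t| + 1)`] with a positive constant `c` which is now allowed to depend on `δ`.»

* `FriedlanderIwaniec2022.goldbachCount n = G(n) = ∑_{m₁+m₂=n, 2∤m₁m₂} Λ(m₁)Λ(m₂)` ((1-2): ODD
  summands, unlike the tree's `Literature.NumberTheory.Sieve.goldbachLambdaCount`);
  `FriedlanderIwaniec2022.WeakHLGoldbach δ` — (4-3), `δ𝔖(n)n < G(n) < (2 − δ)𝔖(n)n` for all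
  large even `n` (a hypothesis PREDICATE; `𝔖` = the tree's `goldbachSingularSeries`, (4-2));
* `friedlanderIwaniec2022_goldbach_theorem` — NAMED FACT, the Theorem of §4 AS PRINTED, the
  conclusion restricted to non-principal characters `χ ≠ 1` (for which `L(s, χ)` is entire; the
  principal case is the classical zero-free region of `ζ`, and avoids the value of Mathlib's total
  `LFunction` at the pole) — weaker than print;
* PROVED: `FriedlanderIwaniec2022.noSiegelZeros` (⇒ the tree's open `NoSiegelZeros`, rh.S34),
  `.not_unboundedSiegelZeros`, and the comparison with the tree's Goldston–Suriajaya hypothesis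
  `FriedlanderIwaniec2022.weakHLGoldbach_of_weakHLGoldbachConj`:
  `WeakHLGoldbachConj δ → WeakHLGoldbach (δ/2)` (for even `n` the two counts differ only by the
  pairs `(2^a, 2^b)`, at most `(log₂ n + 1)(log 2)(log n) = o(n)`), whence
  **`FriedlanderIwaniec2022.noSiegelZeros_of_weakHLGoldbachConj`**: the tree's hypothesis already
  settles `NoSiegelZeros` (modulo the named fact), upgrading `GoldstonSuriajaya2021_goldbach_holds`.

Index only: §5's generalised conclusion (5-4) for `F(n) = ∑ a(ℓ)b(m)` with almost-prime supports
(§§5–14, heuristic in part); the earlier exits [Fei 2016; Bhowmik et al. 2019; Bhowmik–Halupczok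
2021; Jia 2022] («narrowed the escape window … but did not close it tightly»; Goldston–Suriajaya's
is the tree's PROVED one).

LABEL: instrument / statement layer (exit). WHAT THIS IS NOT: no claim about Goldbach; the
hypothesis (4-3) is open and «seemingly far from reach»; nothing here bears on parity.

## References

* [FriedlanderIwaniec2022] J. B. Friedlander, H. Iwaniec, *Exceptional zeros, sieve parity,
  Goldbach*, Essent. Number Theory 1 (2022), no. 1, 13–39, doi:10.2140/ent.2022.1.13: §1 (1-1),
  (1-2); §4 (4-1)–(4-3), Theorem (p. 21); §5 (5-4).
* [FriedlanderEtAl2022] J. B. Friedlander, D. A. Goldston, H. Iwaniec, A. I. Suriajaya,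
  *Exceptional zeros and the Goldbach problem*, J. Number Theory 233 (2022) 78–86 (the proof; not
  held, acq-06038).
* [GoldstonSuriajaya2021] D. A. Goldston, A. I. Suriajaya, arXiv:2104.09407, (5) and Theorem 1
  (the tree's `WeakHLGoldbachConj`, `GoldstonSuriajaya2021_goldbach_holds`).
-/

noncomputable section

open Finset Real
open scoped ArithmeticFunction.vonMangoldt
open Literature.Barriers.Parity Literature.NumberTheory.Sieve

namespace Literature.NumberTheory.LFunctions

namespace FriedlanderIwaniec2022

/-- **`G(n) = ∑_{m₁ + m₂ = n, 2 ∤ m₁m₂} Λ(m₁)Λ(m₂)`** (ordered pairs of ODD summands).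
[cite: FriedlanderIwaniec2022, §1 (1-2) and §4 (4-1)] -/
def goldbachCount (n : ℕ) : ℝ :=
  ∑ ab ∈ antidiagonal n with (Odd ab.1 ∧ Odd ab.2), Λ ab.1 * Λ ab.2

/-- **The weak Hardy–Littlewood–Goldbach bound (4-3)** (the paper's hypothesis): «for all
sufficiently large even `n`, we have `δ𝔖(n)n < G(n) < (2 − δ)𝔖(n)n`, for some fixed `0 < δ < 1`» —
here as a PREDICATE in `δ` (never asserted; cf. the tree's
`Literature.Barriers.Parity.WeakHLGoldbachConj`, compared below), with `𝔖 = goldbachSingularSeries`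
((4-2) = the tree's `2C₂ ∏_{p∣n, p>2}(p−1)/(p−2)`). [cite: FriedlanderIwaniec2022, §4 (4-2)–(4-3)] -/
def WeakHLGoldbach (δ : ℝ) : Prop :=
  ∃ n₀ : ℕ, ∀ n : ℕ, n₀ ≤ n → Even n →
    δ * (goldbachSingularSeries n * n) < goldbachCount n ∧
      goldbachCount n < (2 - δ) * (goldbachSingularSeries n * n)

end FriedlanderIwaniec2022

/-- **Friedlander–Iwaniec 2022, §4 Theorem (proved in Friedlander–Goldston–Iwaniec–Suriajaya 2022;
NAMED FACT, as printed, conclusion restricted to `χ ≠ 1`).** «Assume that [the weak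
Hardy–Littlewood–Goldbach bound (4-3)] holds for all sufficiently large even `n`. Then, there are
no zeros of any Dirichlet `L`-function in the region (1-1) with a positive constant `c` which is now
allowed to depend on `δ`», (1-1) being `σ ≥ 1 − c/log q(|t| + 1)`. Rendered: for `0 < δ < 1`,
`WeakHLGoldbach δ` implies that there is `c > 0` such that for every `q ≥ 3`, every non-principal
`χ` mod `q` and every `s` with `Re s ≥ 1 − c/log(q(|Im s| + 1))`, `L(s, χ) ≠ 0`. Not proved here
(Bombieri's log-free density theorem with the exceptional-zero repulsion, FGIS (4.3)).
[cite: FriedlanderIwaniec2022, §4 Theorem (p. 21) and §1 (1-1)] [cite: FriedlanderEtAl2022, main theorem] -/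
def friedlanderIwaniec2022_goldbach_theorem : Prop :=
  ∀ δ : ℝ, 0 < δ → δ < 1 → FriedlanderIwaniec2022.WeakHLGoldbach δ →
    ∃ c : ℝ, 0 < c ∧ ∀ (q : ℕ) [NeZero q], 3 ≤ q → ∀ χ : DirichletCharacter ℂ q, χ ≠ 1 →
      ∀ s : ℂ, 1 - c / Real.log (q * (|s.im| + 1)) ≤ s.re → χ.LFunction s ≠ 0

namespace FriedlanderIwaniec2022

/-! ### PROVED readings -/

/-- **The exit lands on rh.S34**: the weak Hardy–Littlewood–Goldbach bound (4-3) implies the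
tree's open `NoSiegelZeros` (real zeros of real primitive characters, the `t = 0` slice of (1-1)),
modulo the named fact. [cite: FriedlanderIwaniec2022, §4 Theorem] -/
theorem noSiegelZeros (h : friedlanderIwaniec2022_goldbach_theorem) {δ : ℝ} (hδ0 : 0 < δ)
    (hδ1 : δ < 1) (hG : WeakHLGoldbach δ) : NoSiegelZeros := by
  obtain ⟨c, hc, hreg⟩ := h δ hδ0 hδ1 hG
  refine ⟨c, hc, fun q _ hq χ _ hprim σ hσ => ?_⟩
  have hne : χ ≠ 1 := ne_one_of_isPrimitive (by omega) hprim
  refine hreg q hq χ hne σ ?_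
  simp only [Complex.ofReal_im, abs_zero, zero_add, mul_one, Complex.ofReal_re]
  exact hσ.le

/-- Hence (4-3) excludes Siegel zeros of unbounded quality (Tao–Teräväinen's
`UnboundedSiegelZeros`), modulo the named fact. [cite: FriedlanderIwaniec2022, §4 Theorem] -/
theorem not_unboundedSiegelZeros (h : friedlanderIwaniec2022_goldbach_theorem) {δ : ℝ}
    (hδ0 : 0 < δ) (hδ1 : δ < 1) (hG : WeakHLGoldbach δ) : ¬ Summit.Parity.GeneralizedHardyLittlewood.UnboundedSiegelZeros :=
  not_unboundedSiegelZeros_of_noSiegelZeros (noSiegelZeros h hδ0 hδ1 hG)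

/-! ### Comparison with the tree's Goldston–Suriajaya hypothesis

`Literature.Barriers.Parity.WeakHLGoldbachConj δ` bounds `ψ₂(n) = ∑_{m+m'=n} Λ(m)Λ(m')` over ALL
ordered pairs (Goldston–Suriajaya (1), (5)), while (1-2) keeps odd summands only. For even `n` a
pair with `m` even and `Λ(m)Λ(m') ≠ 0` has `m = 2^a`, so the counts differ by at most
`(log₂ n + 1) · log 2 · log n`, which is `< (δ/2) 𝔖(n) n` for large `n` (`𝔖(n) ≥ 1`). -/

/-- `G(n) ≤ ψ₂(n)` (drop the parity condition; all terms are `≥ 0`). [folklore] -/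
private theorem goldbachCount_le (n : ℕ) : goldbachCount n ≤ goldbachLambdaCount n := by
  unfold goldbachCount goldbachLambdaCount
  refine Finset.sum_le_sum_of_subset_of_nonneg (Finset.filter_subset _ _) fun ab _ _ => ?_
  exact mul_nonneg ArithmeticFunction.vonMangoldt_nonneg ArithmeticFunction.vonMangoldt_nonneg

/-- An even prime power is a power of `2`. [folklore] -/
private theorem eq_two_pow_of_isPrimePow_of_even {m : ℕ} (hm : IsPrimePow m) (he : Even m) :
    ∃ k : ℕ, 1 ≤ k ∧ m = 2 ^ k := by
  obtain ⟨p, k, hp, hk, rfl⟩ := hm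
  have hp' : p.Prime := Nat.prime_iff.mpr hp
  have h2 : 2 ∣ p := by
    have : 2 ∣ p ^ k := even_iff_two_dvd.mp he
    exact Nat.Prime.dvd_of_dvd_pow Nat.prime_two this
  have hp2 : p = 2 := ((Nat.prime_dvd_prime_iff_eq Nat.prime_two hp').mp h2).symm
  exact ⟨k, hk, by rw [hp2]⟩

/-- For even `n`, `ψ₂(n) − G(n) ≤ (log₂ n + 1) · log 2 · log n`: the extra pairs `(m, m')` have `m`
even, and contribute only when `m = 2^a` (`1 ≤ a ≤ log₂ n`), each at most `Λ(2^a)Λ(m') ≤ log 2 · log n`.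
[folklore] -/
private theorem goldbachLambdaCount_sub_le {n : ℕ} (hn : Even n) :
    goldbachLambdaCount n - goldbachCount n ≤ (Nat.log 2 n + 1) * (Real.log 2 * Real.log n) := by
  have hlogn : 0 ≤ Real.log n := Real.log_natCast_nonneg n
  have hlog2 : 0 ≤ Real.log 2 := Real.log_nonneg (by norm_num)
  set c : ℝ := Real.log 2 * Real.log n with hc
  have hc0 : 0 ≤ c := mul_nonneg hlog2 hlogn
  set S : Finset ℕ := (Finset.Icc 1 (Nat.log 2 n)).image (fun k => 2 ^ k) with hS
  -- split `ψ₂` into the odd-odd part `G(n)` and the rest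
  have hsplit : goldbachLambdaCount n - goldbachCount n =
      ∑ ab ∈ antidiagonal n with ¬ (Odd ab.1 ∧ Odd ab.2), Λ ab.1 * Λ ab.2 := by
    unfold goldbachLambdaCount goldbachCount
    rw [← Finset.sum_filter_add_sum_filter_not (antidiagonal n) (fun ab => Odd ab.1 ∧ Odd ab.2)]
    ring
  rw [hsplit]
  -- pointwise: a remaining term vanishes unless `ab.1 ∈ S`, and then it is `≤ c`
  have hpt : ∀ ab ∈ (antidiagonal n).filter (fun ab => ¬ (Odd ab.1 ∧ Odd ab.2)),
      Λ ab.1 * Λ ab.2 ≤ if ab.1 ∈ S then c else 0 := by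
    intro ab hab
    rw [Finset.mem_filter, Finset.HasAntidiagonal.mem_antidiagonal] at hab
    obtain ⟨hsum, hnotodd⟩ := hab
    by_cases hpp : IsPrimePow ab.1
    · have heven : Even ab.1 := by
        by_contra hne
        have hodd : Odd ab.1 := Nat.not_even_iff_odd.mp hne
        have h2 : Odd ab.2 := by
          rcases Nat.even_or_odd ab.2 with h | h
          · exfalso
            have : Odd n := by rw [← hsum]; exact hodd.add_even h
            exact (Nat.not_even_iff_odd.mpr this) hn
          · exact h
        exact hnotodd ⟨hodd, h2⟩
      obtain ⟨k, hk1, hk⟩ := eq_two_pow_of_isPrimePow_of_even hpp heven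
      have hmem : ab.1 ∈ S := by
        rw [hS, Finset.mem_image]
        refine ⟨k, Finset.mem_Icc.mpr ⟨hk1, ?_⟩, hk.symm⟩
        exact Nat.le_log_of_pow_le (by norm_num) (by rw [← hk]; omega)
      rw [if_pos hmem]
      have h1 : Λ ab.1 = Real.log 2 := by
        rw [hk, ArithmeticFunction.vonMangoldt_apply_pow (by omega),
          ArithmeticFunction.vonMangoldt_apply_prime Nat.prime_two]
        norm_num
      have h2 : Λ ab.2 ≤ Real.log n := by
        rcases Nat.eq_zero_or_pos ab.2 with h0 | hpos
        · rw [h0, ArithmeticFunction.map_zero]; exact hlogn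
        · exact ArithmeticFunction.vonMangoldt_le_log.trans
            (Real.log_le_log (by exact_mod_cast hpos) (by exact_mod_cast (show ab.2 ≤ n by omega)))
      rw [h1, hc]
      exact mul_le_mul_of_nonneg_left h2 hlog2
    · rw [ArithmeticFunction.vonMangoldt_eq_zero_iff.mpr hpp, zero_mul]
      split_ifs
      · exact hc0
      · exact le_rfl
  refine (Finset.sum_le_sum hpt).trans ?_
  -- count: `∑ [ab.1 ∈ S] c ≤ c · #S ≤ c · log₂ n`
  have hS_card : S.card ≤ Nat.log 2 n := by
    calc S.card ≤ (Finset.Icc 1 (Nat.log 2 n)).card := Finset.card_image_le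
      _ = Nat.log 2 n := by simp
  calc ∑ ab ∈ (antidiagonal n).filter (fun ab => ¬ (Odd ab.1 ∧ Odd ab.2)),
        (if ab.1 ∈ S then c else 0)
      ≤ ∑ ab ∈ antidiagonal n, (if ab.1 ∈ S then c else 0) :=
        Finset.sum_le_sum_of_subset_of_nonneg (Finset.filter_subset _ _)
          (fun ab _ _ => by split_ifs <;> [exact hc0; exact le_rfl])
    _ = ∑ m ∈ Finset.range (n + 1), (if m ∈ S then c else 0) :=
        Finset.Nat.sum_antidiagonal_eq_sum_range_succ (fun a _ => if a ∈ S then c else 0) n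
    _ = c * (((Finset.range (n + 1)).filter (· ∈ S)).card : ℝ) := by
        rw [← Finset.sum_filter, Finset.sum_const, nsmul_eq_mul, mul_comm]
    _ ≤ c * (S.card : ℝ) := by
        gcongr
        rw [Finset.filter_mem_eq_inter]
        exact Finset.inter_subset_right
    _ ≤ c * (Nat.log 2 n : ℝ) := by gcongr
    _ ≤ (Nat.log 2 n + 1) * (Real.log 2 * Real.log n) := by rw [hc]; nlinarith

/-- The correction `(log₂ n + 1) log 2 · log n` is eventually below `(δ/2) n` (`δ > 0`): with
`log n ≤ 4 n^{1/4}` and `log₂ n ≤ 2 log n` it is `≤ 36 n^{1/2}`. [folklore] -/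
private theorem correction_lt {δ : ℝ} (hδ : 0 < δ) :
    ∃ n₁ : ℕ, ∀ n : ℕ, n₁ ≤ n →
      (Nat.log 2 n + 1) * (Real.log 2 * Real.log n) < δ / 2 * n := by
  refine ⟨⌈(72 / δ) ^ 2⌉₊ + 2, fun n hn => ?_⟩
  have hn2 : 2 ≤ n := by omega
  have hn1 : (1 : ℝ) ≤ n := by exact_mod_cast (by omega : 1 ≤ n)
  have hn0 : (0 : ℝ) < n := by linarith
  have hlogn0 : 0 ≤ Real.log n := Real.log_nonneg hn1
  -- `log n ≤ 4 n^{1/4}`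
  have hlog : Real.log n ≤ 4 * (n : ℝ) ^ (1 / 4 : ℝ) := by
    have := Real.log_le_rpow_div hn0.le (by norm_num : (0 : ℝ) < 1 / 4)
    linarith [show (n : ℝ) ^ (1 / 4 : ℝ) / (1 / 4) = 4 * (n : ℝ) ^ (1 / 4 : ℝ) by ring]
  -- `log₂ n ≤ 2 log n`
  have hL : (Nat.log 2 n : ℝ) ≤ 2 * Real.log n := by
    have h2 : ((2 : ℕ) : ℝ) ^ Nat.log 2 n ≤ n := by
      exact_mod_cast Nat.pow_log_le_self 2 (by omega : n ≠ 0)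
    have h2' : (Nat.log 2 n : ℝ) * Real.log 2 ≤ Real.log n := by
      rw [← Real.log_pow]
      exact Real.log_le_log (by positivity) (by exact_mod_cast h2)
    have hlog2 : (1 / 2 : ℝ) < Real.log 2 := by linarith [Real.log_two_gt_d9]
    nlinarith [Nat.cast_nonneg (α := ℝ) (Nat.log 2 n)]
  have hlog2le : Real.log 2 ≤ 1 := by
    have := Real.log_two_lt_d9; linarith
  set r : ℝ := (n : ℝ) ^ (1 / 4 : ℝ) with hr
  have hr1 : 1 ≤ r := Real.one_le_rpow hn1 (by norm_num)
  have hr2 : r * r = (n : ℝ) ^ (1 / 2 : ℝ) := by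
    rw [hr, ← Real.rpow_add hn0]; norm_num
  have hsq : (n : ℝ) ^ (1 / 2 : ℝ) * (n : ℝ) ^ (1 / 2 : ℝ) = n := by
    rw [← Real.rpow_add hn0]; norm_num
  -- the correction is `≤ (8r + 1) · 1 · 4r ≤ 36 r²`
  have hbound : (Nat.log 2 n + 1) * (Real.log 2 * Real.log n) ≤ 36 * (n : ℝ) ^ (1 / 2 : ℝ) := by
    have h1 : (Nat.log 2 n : ℝ) + 1 ≤ 8 * r + 1 := by linarith
    have h2 : Real.log 2 * Real.log n ≤ 4 * r := by nlinarith
    calc (Nat.log 2 n + 1) * (Real.log 2 * Real.log n) ≤ (8 * r + 1) * (4 * r) := by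
          apply mul_le_mul h1 h2 (by positivity) (by positivity)
      _ ≤ 36 * (r * r) := by nlinarith
      _ = 36 * (n : ℝ) ^ (1 / 2 : ℝ) := by rw [hr2]
  -- and `36 n^{1/2} < (δ/2) n` since `n^{1/2} > 72/δ`
  have hroot : 72 / δ < (n : ℝ) ^ (1 / 2 : ℝ) := by
    have h1 : (72 / δ) ^ 2 < (n : ℝ) := by
      have : ((⌈(72 / δ) ^ 2⌉₊ : ℕ) : ℝ) + 2 ≤ n := by exact_mod_cast hn
      linarith [Nat.le_ceil ((72 / δ) ^ 2)]
    have h72 : 0 ≤ 72 / δ := by positivity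
    calc 72 / δ = ((72 / δ) ^ 2) ^ (1 / 2 : ℝ) := by
          rw [← Real.sqrt_eq_rpow, Real.sqrt_sq h72]
      _ < (n : ℝ) ^ (1 / 2 : ℝ) := Real.rpow_lt_rpow (by positivity) h1 (by norm_num)
  have hpos : 0 < (n : ℝ) ^ (1 / 2 : ℝ) := by positivity
  have h1 : 36 < δ / 2 * (n : ℝ) ^ (1 / 2 : ℝ) := by
    have := (div_lt_iff₀ hδ).mp hroot
    linarith
  have : 36 * (n : ℝ) ^ (1 / 2 : ℝ) < δ / 2 * n := by
    calc 36 * (n : ℝ) ^ (1 / 2 : ℝ) < δ / 2 * (n : ℝ) ^ (1 / 2 : ℝ) * (n : ℝ) ^ (1 / 2 : ℝ) :=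
          mul_lt_mul_of_pos_right h1 hpos
      _ = δ / 2 * n := by rw [mul_assoc, hsq]
  linarith

/-- **The tree's Goldston–Suriajaya hypothesis implies (4-3)**: `WeakHLGoldbachConj δ` (all ordered
pairs, non-strict) gives `WeakHLGoldbach (δ/2)` (odd pairs, strict), since `𝔖(n) ≥ 1` for even `n`
and the two counts differ by `o(n)`. [cite: FriedlanderIwaniec2022, §1 (1-2), §4 (4-3)]
[cite: GoldstonSuriajaya2021, §1 (1), (5)] -/
theorem weakHLGoldbach_of_weakHLGoldbachConj {δ : ℝ} (hδ0 : 0 < δ)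
    (h : WeakHLGoldbachConj δ) : WeakHLGoldbach (δ / 2) := by
  obtain ⟨n₀, hn₀⟩ := h
  obtain ⟨n₁, hn₁⟩ := correction_lt hδ0
  refine ⟨max n₀ (max n₁ 1), fun n hn heven => ?_⟩
  have hn0' : n₀ ≤ n := le_trans (le_max_left _ _) hn
  have hn1' : n₁ ≤ n := le_trans (le_trans (le_max_left _ _) (le_max_right _ _)) hn
  have hnne : n ≠ 0 := by have := le_trans (le_trans (le_max_right _ _) (le_max_right _ _)) hn; omega
  obtain ⟨hlo, hhi⟩ := hn₀ n hn0' heven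
  have hS : 1 ≤ goldbachSingularSeries n := MontgomeryVaughan1975.one_le_goldbachSingularSeries heven
  have hnpos : (0 : ℝ) < n := by exact_mod_cast Nat.pos_of_ne_zero hnne
  have hcorr := hn₁ n hn1'
  have hdiff := goldbachLambdaCount_sub_le heven
  have hle := goldbachCount_le n
  have hSn : (n : ℝ) ≤ goldbachSingularSeries n * n := by nlinarith
  have hA : δ / 2 * (n : ℝ) ≤ δ / 2 * (goldbachSingularSeries n * n) :=
    mul_le_mul_of_nonneg_left hSn (by positivity)
  have hSpos : 0 < goldbachSingularSeries n * n := by nlinarith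
  have hB : 0 < δ / 2 * (goldbachSingularSeries n * n) := by positivity
  constructor
  · -- `G ≥ ψ₂ − corr > δ𝔖n − (δ/2) n ≥ (δ/2) 𝔖 n`
    linarith
  · -- `G ≤ ψ₂ ≤ (2 − δ)𝔖n < (2 − δ/2)𝔖n`
    linarith

/-- **Upgrade of the tree's Goldston–Suriajaya exit**: the weak Hardy–Littlewood–Goldbach bound in
the tree's form (`WeakHLGoldbachConj δ`, some `0 < δ < 1`) implies `NoSiegelZeros`,
modulo the named fact `friedlanderIwaniec2022_goldbach_theorem` (unconditionally the tree proves
only the `C(δ)/log² q` repulsion, `GoldstonSuriajaya2021_goldbach_holds`).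
[cite: FriedlanderIwaniec2022, §4 Theorem] [cite: GoldstonSuriajaya2021, Theorem 1] -/
theorem noSiegelZeros_of_weakHLGoldbachConj (h : friedlanderIwaniec2022_goldbach_theorem) {δ : ℝ}
    (hδ0 : 0 < δ) (hδ1 : δ < 1) (hG : WeakHLGoldbachConj δ) : NoSiegelZeros :=
  noSiegelZeros h (half_pos hδ0) (by linarith) (weakHLGoldbach_of_weakHLGoldbachConj hδ0 hG)

end FriedlanderIwaniec2022

end Literature.NumberTheory.LFunctions

end
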